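import Summits.CriticalPhenomena.PercolationContinuityZ3.Theorems.PercNearOneGluingNoHeavyLowerTailQ44VertexCoverConeW

/-!
# Universality of the terminal-edge cone (Conjecture W programme): one membership per gadget suffices

Support file for crux `stmt-CriticalPhenomena-4575` (rows `W = 2·Q44`, `U`, `D_U`, `S3` for all `n`), seat `prim-bnk-1` gen 39;
memo `run/shared/lean/prim/prim-l12/FROM-prim-bnk-1-gen39-TT-CONE-UNIVERSAL.md`.

SETTING (see `…Q44VertexCoverConeW`).  A gadget (an internal component of a two-copy fibre graph, with its edges to the
terminals `a b c y`) acts on two-copy kernels through its antipodal pair table `G(s,t) = #{S ⊆ E(gadget) : glue S = s,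
glue (E∖S) = t}`: `(G·K)(x,y) = Σ_{s,t} G(s,t) K(x ∨ s, y ∨ t)`.  The 17 generators of the vertex-cover class are the tables
`gadget g`; here `tact G` is the same action for an ARBITRARY table `G : Fin 15 → Fin 15 → ℕ` (any internal component of any
multigraph), and `tactList` composes several of them (a fibre graph = its list of internal components + a terminal-edge word).

THIS FILE proves, by pure finite algebra:
* `tact_comm`: all table actions commute (the join `pjoin` is commutative and associative — `decide`).
* `inCone_tact_of_base` (**universality**): let the rays of an `Invariant` cone be positive multiples of images of a base kernel
  `K₀` under generator words (`(g k) • rays k = actWord (w k) K₀`).  If a table `G` maps the single kernel `K₀` into the cone,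
  then `G` maps the WHOLE cone into itself (`G·rays k = G·actWord (w k) K₀ /g k = actWord (w k) (G·K₀)/g k`, and words preserve the
  cone).  Hence (`tactList_botbot_nonneg_of_base`) every kernel `tactList Gs (actWord wd K₀)` built from such tables has a
  nonnegative `(⊥,⊥)` entry = nonnegative two-copy fibre defect.
* The instantiation for `W = 2·Q44`: the 35 rays `raysW` of the landed certificate ARE (halves of, for rays 16 and 34) images of
  the kernel under TERMINAL-EDGE words (`raysW_words`, proved from 34 one-step identities `raysW_step` checked by `native_decide`
  — computational — and the suffix-closed word table `wordsW`), so **`tactList_botbot_nonneg_W`: for every list of tables `Gs`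
  each satisfying the single membership `InCone raysW (tact G K_W)` and every vertex-cover word `wd`,
  `0 ≤ (tactList Gs (actWord wd K_W))(⊥,⊥)`.**  One LP certificate per internal-component TYPE therefore extends Conjecture W
  (fibre form) to every multigraph built from such components; the seat's exact certificates cover all components with ≤ 3
  internal vertices (memo §2: 2 723 simple types × 4 kernels, plus an exact multiplicity-reduction identity) and ≈ 1.9 M sampled
  larger ones with 0 failures ("TT-DOMINANCE" conjecture TD, memo §1).
No sorries, no named facts; standard axioms + `Lean.ofReduceBool` (`native_decide` in `raysW_step` only).
-/

namespace Summit.CriticalPhenomena.PercolationContinuityZ3.Theorems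

namespace VCCone

open Finset TwoCopyMono

/-! ## Arbitrary gadget tables and their (commuting) action -/

/-- The antipodal pair table of an arbitrary gadget: `G s t = #{S ⊆ E : glue S = s, glue (E∖S) = t}`. [this work] -/
abbrev Table := Fin 15 → Fin 15 → ℕ

/-- Action of a table on kernels: `(G·K)(x,y) = Σ_{s,t} G(s,t) K(x∨s, y∨t)`. [this work] -/
def tact (G : Table) (K : Ker) : Ker :=
  fun x y => ∑ s : Fin 15, ∑ t : Fin 15, (G s t : ℤ) * K (pjoin x s) (pjoin y t)

/-- Several tables acting one after the other (a fibre graph = the list of its internal components). [this work] -/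
def tactList : List Table → Ker → Ker
  | [], K => K
  | G :: Gs, K => tact G (tactList Gs K)

/-- The 17 generator actions are table actions. [this work] -/
theorem act_eq_tact (g : Fin 17) (K : Ker) : act g K = tact (gadget g) K := rfl

/-- The join of cells is commutative (table fact). [this work] -/
theorem pjoin_comm : ∀ i j : Fin 15, pjoin i j = pjoin j i := by decide

/-- The join of cells is associative (table fact). [this work] -/
theorem pjoin_assoc : ∀ i j k : Fin 15, pjoin (pjoin i j) k = pjoin i (pjoin j k) := by decide

/-- Right-commutativity of iterated joins. [this work] -/
theorem pjoin_right_comm (x s t : Fin 15) : pjoin (pjoin x s) t = pjoin (pjoin x t) s := by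
  rw [pjoin_assoc, pjoin_comm s t, ← pjoin_assoc]

/-- The action as a single sum over pairs of cells. [this work] -/
theorem tact_apply_prod (G : Table) (K : Ker) (x y : Fin 15) :
    tact G K x y = ∑ p : Fin 15 × Fin 15, (G p.1 p.2 : ℤ) * K (pjoin x p.1) (pjoin y p.2) := by
  unfold tact
  rw [← Finset.sum_product']
  rfl

/-- **All gadget actions commute.** [this work] -/
theorem tact_comm (G H : Table) (K : Ker) : tact G (tact H K) = tact H (tact G K) := by
  funext x y
  rw [tact_apply_prod, tact_apply_prod]
  simp_rw [tact_apply_prod, Finset.mul_sum]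
  rw [Finset.sum_comm]
  refine Finset.sum_congr rfl fun q _ => Finset.sum_congr rfl fun p _ => ?_
  rw [pjoin_right_comm x p.1 q.1, pjoin_right_comm y p.2 q.2]
  ring

/-- `tact` is additive. [this work] -/
theorem tact_add (G : Table) (K L : Ker) (x y : Fin 15) :
    tact G (fun i j => K i j + L i j) x y = tact G K x y + tact G L x y := by
  unfold tact
  rw [← Finset.sum_add_distrib]
  refine Finset.sum_congr rfl fun s _ => ?_
  rw [← Finset.sum_add_distrib]
  refine Finset.sum_congr rfl fun t _ => ?_
  ring

/-- `tact` commutes with integer scalars. [this work] -/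
theorem tact_smul (G : Table) (c : ℤ) (K : Ker) (x y : Fin 15) :
    tact G (fun i j => c * K i j) x y = c * tact G K x y := by
  unfold tact
  rw [Finset.mul_sum]
  refine Finset.sum_congr rfl fun s _ => ?_
  rw [Finset.mul_sum]
  refine Finset.sum_congr rfl fun t _ => ?_
  ring

/-- `tact` commutes with finite sums. [this work] -/
theorem tact_finsum {ι : Type*} (S : Finset ι) (G : Table) (F : ι → Ker) (x y : Fin 15) :
    tact G (fun i j => ∑ k ∈ S, F k i j) x y = ∑ k ∈ S, tact G (F k) x y := by
  classical
  induction S using Finset.induction_on with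
  | empty =>
    have h0 : (fun i j : Fin 15 => ∑ k ∈ (∅ : Finset ι), F k i j) = fun _ _ => (0 : ℤ) := by
      funext i j; exact Finset.sum_empty
    rw [h0, Finset.sum_empty]
    unfold tact
    simp
  | insert a S ha ih =>
    have hfun : (fun i j : Fin 15 => ∑ k ∈ insert a S, F k i j) = fun i j => F a i j + ∑ k ∈ S, F k i j := by
      funext i j; exact Finset.sum_insert ha
    rw [hfun, tact_add, ih, Finset.sum_insert ha]

/-- `tact` is monotone (tables are nonnegative). [this work] -/
theorem tact_mono (G : Table) {K L : Ker} (h : ∀ i j, K i j ≤ L i j) (x y : Fin 15) :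
    tact G K x y ≤ tact G L x y := by
  unfold tact
  refine Finset.sum_le_sum fun s _ => Finset.sum_le_sum fun t _ => ?_
  exact mul_le_mul_of_nonneg_left (h _ _) (by positivity)

/-- A table action commutes with a generator action. [this work] -/
theorem tact_act_comm (G : Table) (g : Fin 17) (K : Ker) : tact G (act g K) = act g (tact G K) := by
  rw [act_eq_tact, act_eq_tact, tact_comm]

/-- A table action commutes with generator words. [this work] -/
theorem tact_actWord_comm (G : Table) (K : Ker) :
    ∀ w : List (Fin 17), tact G (actWord w K) = actWord w (tact G K)
  | [] => rfl
  | g :: w => by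
    show tact G (act g (actWord w K)) = act g (actWord w (tact G K))
    rw [tact_act_comm, tact_actWord_comm G K w]

/-! ## Closure properties of the cone -/

variable {R : ℕ} (rays : Fin R → Ker)

/-- The cone is upward closed. [this work] -/
theorem inCone_mono {A B : Ker} (hA : InCone rays A) (h : ∀ x y, A x y ≤ B x y) : InCone rays B := by
  obtain ⟨c, hc, μ, hμ⟩ := hA.le
  exact ⟨⟨c, hc, μ, fun x y => (hμ x y).trans (mul_le_mul_of_nonneg_left (h x y) (by positivity))⟩⟩

/-- The zero kernel is in the cone. [this work] -/
theorem inCone_zero : InCone rays (fun _ _ => 0) :=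
  ⟨⟨1, Nat.one_pos, fun _ => 0, fun x y => by simp⟩⟩

/-- The cone is closed under addition. [this work] -/
theorem inCone_add {A B : Ker} (hA : InCone rays A) (hB : InCone rays B) :
    InCone rays (fun i j => A i j + B i j) := by
  obtain ⟨c, hc, μ, hμ⟩ := hA.le
  obtain ⟨c', hc', μ', hμ'⟩ := hB.le
  refine ⟨⟨c * c', Nat.mul_pos hc hc', fun k => c' * μ k + c * μ' k, fun x y => ?_⟩⟩
  have e1 : (∑ k : Fin R, ((c' * μ k + c * μ' k : ℕ) : ℤ) * rays k x y) =
      (c' : ℤ) * ∑ k : Fin R, (μ k : ℤ) * rays k x y + (c : ℤ) * ∑ k : Fin R, (μ' k : ℤ) * rays k x y := by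
    rw [Finset.mul_sum, Finset.mul_sum, ← Finset.sum_add_distrib]
    refine Finset.sum_congr rfl fun k _ => ?_
    push_cast; ring
  rw [e1]
  have h1 := mul_le_mul_of_nonneg_left (hμ x y) (show (0 : ℤ) ≤ c' by positivity)
  have h2 := mul_le_mul_of_nonneg_left (hμ' x y) (show (0 : ℤ) ≤ c by positivity)
  calc (c' : ℤ) * ∑ k : Fin R, (μ k : ℤ) * rays k x y + (c : ℤ) * ∑ k : Fin R, (μ' k : ℤ) * rays k x y
      ≤ (c' : ℤ) * ((c : ℤ) * A x y) + (c : ℤ) * ((c' : ℤ) * B x y) := add_le_add h1 h2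
    _ = ((c * c' : ℕ) : ℤ) * (A x y + B x y) := by push_cast; ring

/-- The cone is closed under natural scalars. [this work] -/
theorem inCone_nsmul {A : Ker} (hA : InCone rays A) (n : ℕ) : InCone rays (fun i j => (n : ℤ) * A i j) := by
  obtain ⟨c, hc, μ, hμ⟩ := hA.le
  refine ⟨⟨c, hc, fun k => n * μ k, fun x y => ?_⟩⟩
  have e1 : (∑ k : Fin R, ((n * μ k : ℕ) : ℤ) * rays k x y) = (n : ℤ) * ∑ k : Fin R, (μ k : ℤ) * rays k x y := by
    rw [Finset.mul_sum]
    refine Finset.sum_congr rfl fun k _ => ?_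
    push_cast; ring
  rw [e1]
  calc (n : ℤ) * ∑ k : Fin R, (μ k : ℤ) * rays k x y ≤ (n : ℤ) * ((c : ℤ) * A x y) :=
        mul_le_mul_of_nonneg_left (hμ x y) (by positivity)
    _ = (c : ℤ) * ((n : ℤ) * A x y) := by ring

/-- The cone is closed under finite sums. [this work] -/
theorem inCone_finsum {ι : Type*} (S : Finset ι) (F : ι → Ker) (h : ∀ k ∈ S, InCone rays (F k)) :
    InCone rays (fun i j => ∑ k ∈ S, F k i j) := by
  classical
  induction S using Finset.induction_on with
  | empty =>
    have h0 : (fun i j : Fin 15 => ∑ k ∈ (∅ : Finset ι), F k i j) = fun _ _ => (0 : ℤ) := by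
      funext i j; exact Finset.sum_empty
    rw [h0]; exact inCone_zero rays
  | insert a S ha ih =>
    have hfun : (fun i j : Fin 15 => ∑ k ∈ insert a S, F k i j) = fun i j => F a i j + ∑ k ∈ S, F k i j := by
      funext i j; exact Finset.sum_insert ha
    rw [hfun]
    exact inCone_add rays (h a (Finset.mem_insert_self a S)) (ih fun k hk => h k (Finset.mem_insert_of_mem hk))

/-- A positive multiple is in the cone only if the kernel is. [this work] -/
theorem inCone_of_nsmul_pos {A : Ker} {n : ℕ} (hn : 0 < n) (hA : InCone rays (fun i j => (n : ℤ) * A i j)) :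
    InCone rays A := by
  obtain ⟨c, hc, μ, hμ⟩ := hA.le
  refine ⟨⟨c * n, Nat.mul_pos hc hn, μ, fun x y => ?_⟩⟩
  calc (∑ k : Fin R, (μ k : ℤ) * rays k x y) ≤ (c : ℤ) * ((n : ℤ) * A x y) := hμ x y
    _ = ((c * n : ℕ) : ℤ) * A x y := by push_cast; ring

/-! ## Universality: one membership per table -/

/-- **Universality of an invariant word cone.**  If every ray is a positive multiple of the image of a base kernel `K₀` under a
generator word, the cone carries an invariance certificate for the generators, and a table `G` maps `K₀` into the cone, then
`G` maps every kernel of the cone into the cone. [this work] -/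
theorem inCone_tact_of_base {d₀ : ℕ} {ν : Fin 17 → Fin R → Fin R → ℕ} (hinv : Invariant rays d₀ ν) {K₀ : Ker}
    (w : Fin R → List (Fin 17)) (g : Fin R → ℕ) (hg : ∀ k, 0 < g k)
    (hw : ∀ k x y, (g k : ℤ) * rays k x y = actWord (w k) K₀ x y)
    {G : Table} (hG : InCone rays (tact G K₀)) {M : Ker} (hM : InCone rays M) : InCone rays (tact G M) := by
  -- each `tact G (rays k)` is in the cone
  have hk : ∀ k, InCone rays (tact G (rays k)) := by
    intro k
    refine inCone_of_nsmul_pos rays (hg k) ?_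
    have e : (fun i j => (g k : ℤ) * tact G (rays k) i j) = actWord (w k) (tact G K₀) := by
      funext i j
      rw [← tact_smul, ← tact_actWord_comm]
      have hfun : (fun i j => (g k : ℤ) * rays k i j) = actWord (w k) K₀ := by
        funext i' j'; exact hw k i' j'
      rw [hfun]
    rw [e]
    exact inCone_actWord rays hinv hG (w k)
  obtain ⟨c, hc, μ, hμ⟩ := hM.le
  -- `c • tact G M` dominates `Σ μ_k tact G (rays k)`, which is in the cone
  have hsum : InCone rays (fun i j => ∑ k : Fin R, (μ k : ℤ) * tact G (rays k) i j) :=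
    inCone_finsum rays Finset.univ (fun k => fun i j => (μ k : ℤ) * tact G (rays k) i j)
      fun k _ => inCone_nsmul rays (hk k) (μ k)
  refine inCone_of_nsmul_pos rays hc (inCone_mono rays hsum fun x y => ?_)
  have e2 : (∑ k : Fin R, (μ k : ℤ) * tact G (rays k) x y) =
      tact G (fun i j => ∑ k : Fin R, (μ k : ℤ) * rays k i j) x y := by
    rw [tact_finsum]
    refine Finset.sum_congr rfl fun k _ => ?_
    rw [tact_smul]
  rw [e2, ← tact_smul]
  exact tact_mono G (fun i j => hμ i j) x y

/-- Lists of such tables preserve the cone. [this work] -/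
theorem inCone_tactList_of_base {d₀ : ℕ} {ν : Fin 17 → Fin R → Fin R → ℕ} (hinv : Invariant rays d₀ ν) {K₀ : Ker}
    (w : Fin R → List (Fin 17)) (g : Fin R → ℕ) (hg : ∀ k, 0 < g k)
    (hw : ∀ k x y, (g k : ℤ) * rays k x y = actWord (w k) K₀ x y) :
    ∀ Gs : List Table, (∀ G ∈ Gs, InCone rays (tact G K₀)) → ∀ {M : Ker}, InCone rays M → InCone rays (tactList Gs M)
  | [], _, _, hM => hM
  | G :: Gs, hGs, _, hM =>
    inCone_tact_of_base rays hinv w g hg hw (hGs G List.mem_cons_self)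
      (inCone_tactList_of_base hinv w g hg hw Gs (fun H hH => hGs H (List.mem_cons_of_mem G hH)) hM)

/-- **Nonnegative fibre defect for every graph built from certified components.**  Under the hypotheses of
`inCone_tact_of_base`, with rays nonnegative at `(⊥,⊥)` and `K₀` in the cone: for every list of tables `Gs` each mapping `K₀`
into the cone and every generator word `wd`, `0 ≤ (tactList Gs (actWord wd K₀))(⊥,⊥)`. [this work] -/
theorem tactList_botbot_nonneg_of_base {d₀ : ℕ} {ν : Fin 17 → Fin R → Fin R → ℕ} (hinv : Invariant rays d₀ ν)
    (h0 : ∀ k, 0 ≤ rays k 0 0) {K₀ : Ker} (hK₀ : InCone rays K₀)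
    (w : Fin R → List (Fin 17)) (g : Fin R → ℕ) (hg : ∀ k, 0 < g k)
    (hw : ∀ k x y, (g k : ℤ) * rays k x y = actWord (w k) K₀ x y)
    (Gs : List Table) (hGs : ∀ G ∈ Gs, InCone rays (tact G K₀)) (wd : List (Fin 17)) :
    0 ≤ tactList Gs (actWord wd K₀) 0 0 :=
  inCone_botbot_nonneg rays h0
    (inCone_tactList_of_base rays hinv w g hg hw Gs hGs (inCone_actWord rays hinv hK₀ wd))

/-! ## Instantiation for `W = 2·Q44`: the 35 rays are terminal-edge words -/

/-- The symmetrised `Q44` kernel (`W = 2·Q44`). [this work] -/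
def kerW : Ker := fun i j => kerQ44 i j + kerQ44 j i

/-- Scaling factors: `(gW k) • raysW k` is a word image of `kerW` (rays 16 and 34 are halves). [this work] -/
def gW (k : Fin 35) : ℕ := if k.1 = 16 ∨ k.1 = 34 then 2 else 1

/-- Head generator (a terminal edge `0 Eab … 5 Ecy`) of the word of ray `k` (`k ≥ 1`). [this work] -/
def hdWTab : Array ℕ :=
  #[0, 0, 1, 2, 3, 4, 5, 0, 0, 0, 0, 0, 1, 1, 1, 1, 2, 2, 2, 3, 3, 4, 0, 0, 0, 0, 0, 0, 0, 1, 1, 1, 1, 2, 0]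

/-- The ray whose word is the tail of the word of ray `k` (`k ≥ 1`). [this work] -/
def prevWTab : Array ℕ :=
  #[0, 0, 0, 0, 0, 0, 0, 2, 3, 4, 5, 6, 3, 4, 5, 6, 4, 5, 6, 5, 6, 6, 12, 14, 15, 18, 19, 20, 21, 17, 19, 20, 21, 21, 32]

/-- Head generator of ray `k`. [this work] -/
def hdW (k : Fin 35) : Fin 17 := ⟨(hdWTab[k.1]!) % 17, Nat.mod_lt _ (by decide)⟩

/-- Tail ray of ray `k`. [this work] -/
def prevW (k : Fin 35) : Fin 35 := ⟨(prevWTab[k.1]!) % 35, Nat.mod_lt _ (by decide)⟩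

/-- The terminal-edge word of ray `k` (as a generator word; entries in `0…5`). [this work] -/
def wordsWTab : Array (List ℕ) :=
  #[[], [0], [1], [2], [3], [4], [5], [0, 1], [0, 2], [0, 3], [0, 4], [0, 5], [1, 2], [1, 3], [1, 4], [1, 5], [2, 3],
    [2, 4], [2, 5], [3, 4], [3, 5], [4, 5], [0, 1, 2], [0, 1, 4], [0, 1, 5], [0, 2, 5], [0, 3, 4], [0, 3, 5], [0, 4, 5],
    [1, 2, 4], [1, 3, 4], [1, 3, 5], [1, 4, 5], [2, 4, 5], [0, 1, 4, 5]]

/-- The word of ray `k`. [this work] -/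
def wordsW (k : Fin 35) : List (Fin 17) :=
  (wordsWTab[k.1]!).map fun n => ⟨n % 17, Nat.mod_lt _ (by decide)⟩

/-- All scaling factors are positive. [this work] -/
theorem gW_pos : ∀ k : Fin 35, 0 < gW k := by decide

/-- The tail ray has a smaller index. [this work] -/
theorem prevW_lt : ∀ k : Fin 35, k ≠ 0 → prevW k < k := by decide

/-- The word table is suffix closed along `prevW`/`hdW`. [this work] -/
theorem wordsW_cons : ∀ k : Fin 35, k ≠ 0 → wordsW k = hdW k :: wordsW (prevW k) := by decide

/-- The empty word belongs to ray 0. [this work] -/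
theorem wordsW_zero : wordsW 0 = [] := by decide

/-- The 34 one-step identities `(gW k)·raysW k = (gW (prevW k))·(E_{hdW k}·raysW (prevW k))` (finite check).
[this work] -/
theorem raysW_step : ∀ k : Fin 35, k ≠ 0 → ∀ x y : Fin 15,
    (gW k : ℤ) * raysW k x y = (gW (prevW k) : ℤ) * act (hdW k) (raysW (prevW k)) x y := by
  native_decide

/-- **The rays of the `W` certificate are terminal-edge word images of the kernel** (up to the factors `gW`). [this work] -/
theorem raysW_words : ∀ k : Fin 35, ∀ x y : Fin 15, (gW k : ℤ) * raysW k x y = actWord (wordsW k) kerW x y := by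
  suffices h : ∀ n : ℕ, ∀ k : Fin 35, k.1 = n → ∀ x y : Fin 15,
      (gW k : ℤ) * raysW k x y = actWord (wordsW k) kerW x y from fun k => h k.1 k rfl
  intro n
  induction n using Nat.strong_induction_on with
  | _ n ih =>
    intro k hk x y
    by_cases h0 : k = 0
    · subst h0
      rw [wordsW_zero]
      show (gW 0 : ℤ) * raysW 0 x y = kerW x y
      rw [raysW_zero x y]
      simp [gW, kerW]
    · rw [raysW_step k h0 x y, wordsW_cons k h0]
      have hlt : (prevW k).1 < n := hk ▸ prevW_lt k h0
      have ihk : ∀ x y, (gW (prevW k) : ℤ) * raysW (prevW k) x y = actWord (wordsW (prevW k)) kerW x y :=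
        ih _ hlt (prevW k) rfl
      have hfun : (fun i j => (gW (prevW k) : ℤ) * raysW (prevW k) i j) = actWord (wordsW (prevW k)) kerW := by
        funext i j; exact ihk i j
      rw [← act_smul, hfun]
      rfl

/-- The kernel `kerW` is in its cone. [this work] -/
theorem inCone_kerW : InCone raysW kerW := inCone_W

/-- **Universality for `W`.**  A table that maps `kerW` into the `W` cone maps the whole cone into itself. [this work] -/
theorem inCone_tact_W {G : Table} (hG : InCone raysW (tact G kerW)) {M : Ker} (hM : InCone raysW M) :
    InCone raysW (tact G M) :=
  inCone_tact_of_base raysW invariant_W wordsW gW gW_pos raysW_words hG hM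

/-- **Conjecture W (fibre form) on every graph built from certified components.**  For every list of gadget tables `Gs`, each
satisfying the single membership `InCone raysW (tact G kerW)`, and every vertex-cover word `wd`:
`0 ≤ (tactList Gs (actWord wd kerW))(⊥,⊥)` — the two-copy fibre defect of `W = 2·Q44` of the fibre graph whose internal
components have the tables `Gs` and whose terminal part is `wd` is nonnegative. [this work] -/
theorem tactList_botbot_nonneg_W (Gs : List Table) (hGs : ∀ G ∈ Gs, InCone raysW (tact G kerW))
    (wd : List (Fin 17)) : 0 ≤ tactList Gs (actWord wd kerW) 0 0 :=
  tactList_botbot_nonneg_of_base raysW invariant_W raysW_botbot inCone_kerW wordsW gW gW_pos raysW_words Gs hGs wd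

end VCCone

end Summit.CriticalPhenomena.PercolationContinuityZ3.Theorems
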